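import Literature.NumberTheory.Automorphic.QuaternionAlgebraAdelicMeasureProofs
import HarnessLib

/-!
# `ℝ_{>0} · Dˣ` is closed in `(D ⊗ 𝔸_K)ˣ` (the subgroup `A_G · G(K)` of the datum `D^×`)

Topic `NumberTheory/Automorphic`; theorems only (no definition, no named fact, no instance).

For an adelic group datum `𝒢` (`AdelicGroupData`) the automorphic quotient is
`G(𝔸_K) ⧸ (A_G · G(K))`, and every use of Weil's integration formula on it — unfolding
(`Literature.MeasureTheory.Group.InvariantQuotientUnfolding`, `GLnAutomorphicUnfolding`), uniqueness
of the automorphic measure (`InvariantQuotientUniqueness`, `AdelicGroupDataUniquenessProofs`), the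
kernel of the operators `R(f)` (trace formula, Gelbart (1975) §9 (9.7), §10 (10.14)) — needs the
subgroup `H = A_G · G(K)` to be **closed**. For `GL_n` this is
`isClosed_quotientSubgroup_gl_holds` (`AdelicGroupDataGLnProofs`). Here:

* `AdelicGroupData.isClosed_quotientSubgroup_units` — **`ℝ_{>0} · Dˣ` is closed in
  `(D ⊗ 𝔸_K)ˣ`** for every finite-dimensional `K`-algebra `D ≠ 0` (in particular every
  quaternion algebra), by the general criterion
  `AdelicGroupData.isClosed_quotientSubgroup_of_centralRetraction` (`AdelicGroupDataCompactMeasure`: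
  `A_G · G(K)` is the preimage of the discrete, hence closed, `G(K)` under `g ↦ θ(g)⁻¹ g`) applied
  to the central retraction `θ(g) = z(‖g‖^{1/N})` of `exists_centralRetraction_units`
  (`QuaternionAlgebraAdelicMeasureProofs`; Weil, *Basic Number Theory*, Ch. IV §4, Cor. 2 of
  Thm. 5: `D_𝔸ˣ = D_𝔸¹ × M`) and the discreteness of `Dˣ` in `D_𝔸ˣ`
  (`units_isDiscreteRational_holds`, Weil Ch. IV §2).
* `AdelicGroupData.locallyCompactSpace_quotientSubgroup_units` — hence `ℝ_{>0} · Dˣ` is a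
  locally compact group (a closed subgroup of the locally compact `D_𝔸ˣ`), so that it carries Haar
  measures (the `ρ` of the kernel formula for `R(f)` on `L²(D_𝔸ˣ ⧸ ℝ_{>0} Dˣ)`).

Part of the inline (D-0026) decomposition of the named fact
`Literature.NumberTheory.Automorphic.strong_multiplicity_one_quaternionUnits` (Gelbart (1975),
Thm. 10.5 (ii): the `D^×` side of the trace-formula comparison, (10.14) = Remark 9.23, lives on the
compact quotient `Z_∞⁺ G'_ℚ \ G'_𝔸`).

## References

* A. Weil, *Basic Number Theory* (1967), Ch. IV §2 (discreteness of `k` in `k_A`), §4 Cor. 2 of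
  Thm. 5 (the splitting `D_A^× = D_A¹ × M`) [WeilBNT1967].
* A. Borel, *Some finiteness properties of adele groups over number fields*, Publ. Math. IHÉS 16
  (1963), §5 [Borel1963].
* S. Gelbart, *Automorphic forms on adele groups* (1975), Remark 9.23, (10.14) [Gelbart1975].
-/

noncomputable section

open NumberField IsDedekindDomain Topology

namespace Literature.NumberTheory.Automorphic

namespace AdelicGroupData

universe u

variable (K : Type) [Field K] [NumberField K] (D : Type u) [Ring D] [Algebra K D]
  [Module.Finite K D] [Nontrivial D]

/-- **`ℝ_{>0} · Dˣ` is closed in `D_𝔸ˣ = (D ⊗ 𝔸_K)ˣ`** for a finite-dimensional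
`K`-algebra `D ≠ 0` over a number field (e.g. a quaternion algebra): the subgroup `A_G · G(K)`
of the datum `AdelicGroupData.units K D` is closed. By
`isClosed_quotientSubgroup_of_centralRetraction` with the central retraction
`θ(g) = z(‖g‖^{1/N})` of `exists_centralRetraction_units` (Weil's splitting `D_A^× = D_A¹ × M`,
BNT Ch. IV §4, Cor. 2 of Thm. 5) and the discreteness of `Dˣ` in `D_𝔸ˣ`
(`units_isDiscreteRational_holds`, Weil Ch. IV §2).
[cite: WeilBNT1967, Ch. IV §4 Cor. 2 of Thm. 5] -/
theorem isClosed_quotientSubgroup_units :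
    IsClosed ((AdelicGroupData.units K D).quotientSubgroup :
      Set (AdelicGroupData.units K D).Adelic) := by
  haveI : LocallyCompactSpace (AdeleRing (𝓞 K) K) := locallyCompactSpace_adeleRing' K
  haveI : T2Space (adelicUnits K D) := t2Space_adelicUnits K D
  haveI : T2Space (AdelicGroupData.units K D).Adelic := ‹T2Space (adelicUnits K D)›
  obtain ⟨θ, hθc, hθA, hθa, hθγ⟩ := exists_centralRetraction_units K D
  exact isClosed_quotientSubgroup_of_centralRetraction (AdelicGroupData.units K D)
    (AdelicGroupData.units_isDiscreteRational_holds K D) θ hθc hθA hθa hθγ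

/-- Hence **`ℝ_{>0} · Dˣ` is a locally compact group** (a closed subgroup of the locally
compact group `D_𝔸ˣ`, itself the unit group of the locally compact Hausdorff ring
`D ⊗ 𝔸_K ≅ 𝔸_K^{dim D}`), so that it carries Haar measures. [folklore] -/
theorem locallyCompactSpace_quotientSubgroup_units :
    LocallyCompactSpace ↥(AdelicGroupData.units K D).quotientSubgroup := by
  haveI : LocallyCompactSpace (AdeleRing (𝓞 K) K) := locallyCompactSpace_adeleRing' K
  haveI : T2Space (AdeleRing (𝓞 K) K) := t2Space_adeleRing K
  haveI : LocallyCompactSpace (adelicUnits K D) := inferInstance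
  haveI : LocallyCompactSpace (AdelicGroupData.units K D).Adelic :=
    ‹LocallyCompactSpace (adelicUnits K D)›
  exact (isClosed_quotientSubgroup_units K D).isClosedEmbedding_subtypeVal.locallyCompactSpace

end AdelicGroupData

end Literature.NumberTheory.Automorphic
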